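import Summits.AtomisticToContinuum.BoseEinsteinCondensation.Theorems.BECGroundStateSOSPeriodicIRBoundDefs
import Summits.AtomisticToContinuum.BoseEinsteinCondensation.Theorems.BECGroundStateSOSPeriodicIRBoundWFDefs
import Literature.MathematicalPhysics.QuantumManyBody.PeriodicBoseGasMomentumSector
import Literature.MathematicalPhysics.QuantumManyBody.TorusFockLayer
import Literature.MathematicalPhysics.QuantumManyBody.TorusFockSectorInteraction
import Literature.MathematicalPhysics.QuantumManyBody.PeriodicFormDomain
import Literature.MathematicalPhysics.QuantumManyBody.PeriodicBoseGasTagged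
import HarnessLib

/-! # Crux `PeriodicIRBound` (stmt-AtomisticToContinuum-3972), line `linear-ph-floor-wagner`, stub 5b `stub_wagnerFeynman` — PotToolkit
Potential toolkit: peeling a particle off cell integrals, relabelling, `∫_cell w^per(x − c) dx = ‖w‖₁`, the tagged split of `W`, the direct term and the exchange bound `|Re E| ≤ ‖w‖₁/L³ ‖Φ‖²`. -/

/-!

`linear-ph-floor-wagner` (crux stmt-AtomisticToContinuum-3972):

* `integral_cellN_succ` (TK1): Bochner Fubini, first particle split off,
  `∫_{cellN (m+1)} F = ∫_{Y ∈ cellN m} ∫_{x ∈ cell} F(x::Y)` for `F` integrable on the cell;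
* `integral_cellN_comp_perm` (TK2): relabelling invariance of Bochner cell integrals;
* `lintegral_cell_periodizedPotential_sub` (TK3): `∫_{cell} w^per(x − c) dx = ‖w‖₁`;
* `lintegral_cell_cell_periodizedPotential` (TK4): `∫_{cell}∫_{cell} w^per(x − y) = L³‖w‖₁`;
* `periodicInteraction_vecCons` (TK5): `W_{m+1}(x::Y) = W_m(Y) + ∑_b w^per(x − y_b)`;
* `lintegral_pot_sq_planeWaveMode_sq_tail` (P-dir): the direct term of `P[a†Φ]`;
* `abs_exchCoef_re_le` (P-c): the exchange bound `|Re E| ≤ ‖w‖₁/L³ ‖Φ‖²`.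

Auxiliary public lemmas: `measurable_periodizedPotential_tk`, `measurable_periodicInteraction_tk`,
`lintegral_cell_periodizedPotential_sub'` (TK3 mirrored), `lintegral_cell_periodicInteraction_add_sum`,
`exchIntegrand`/`exchCoef_eq`, `two_mul_enorm_exchIntegrand_le`, `lintegral_lintegral_two_mul_enorm_exchIntegrand_le`;
-/

noncomputable section

open scoped BigOperators ENNReal ComplexConjugate
open Filter MeasureTheory

namespace Summit.AtomisticToContinuum.BoseEinsteinCondensation.Cruxes.PeriodicIRBound.LinearPhFloorWagner.WF

open Literature.MathematicalPhysics.QuantumManyBody.BoseGas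

variable {M m : ℕ} {L : ℝ}

/-! ## Toolkit -/

/-- TK5 (splitting off the first particle's pairs): `W_{m+1}(x::Y) = W_m(Y) + ∑_b w^per(x - y_b)` — the tree's
`periodicInteraction_succ` in the `vecCons` form used here. -/
theorem periodicInteraction_vecCons (w : ℝ → ℝ≥0∞) (L : ℝ) (x : Space) (Y : Config m) :
    periodicInteraction w L (Matrix.vecCons x Y) = periodicInteraction w L Y + ∑ b : Fin m, periodizedPotential w L (x - Y b) := by
  rw [periodicInteraction_succ, Matrix.tail_cons, add_comm]
  simp only [Matrix.cons_val_zero, Matrix.cons_val_succ]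

/-- TK2 (relabelling invariance, Bochner): `∫_{cellN} F(X ∘ σ) = ∫_{cellN} F(X)` for every `F` (no integrability needed:
`MeasurePreserving.integral_comp'` of the relabelling equivalence, which preserves `cellN`). -/
theorem integral_cellN_comp_perm (L : ℝ) (σ : Equiv.Perm (Fin M)) (F : Config M → ℂ) :
    ∫ X in cellN M L, F (X ∘ σ) = ∫ X in cellN M L, F X := by
  set e := (MeasurableEquiv.piCongrLeft (fun _ : Fin M => Space) σ).symm
  have hmp : MeasurePreserving e volume volume :=
    (volume_measurePreserving_piCongrLeft (fun _ : Fin M => Space) σ).symm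
  have heX : ∀ (X : Config M) (j : Fin M), e X j = X (σ j) := fun X j => rfl
  have hpre : e ⁻¹' cellN M L = cellN M L := by
    ext X
    simp only [Set.mem_preimage, cellN, Set.mem_setOf_eq, heX]
    exact ⟨fun h i => by simpa using h (σ.symm i), fun h i => h _⟩
  have key := hmp.setIntegral_preimage_emb e.measurableEmbedding F (cellN M L)
  rwa [hpre] at key

/-- `(x, Y) ↦ x :: Y` is the inverse of the splitting equivalence `X ↦ (x₀, X̂₀)`. -/
theorem piFinSuccAbove_symm_apply_tk (p : Space × Config m) :
    (MeasurableEquiv.piFinSuccAbove (fun _ : Fin (m + 1) => Space) 0).symm p = Matrix.vecCons p.1 p.2 := by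
  change Fin.insertNth 0 p.1 p.2 = (Fin.cons p.1 p.2 : Config (m + 1))
  exact Fin.insertNth_zero' p.1 p.2

/-- TK1 (Bochner Fubini, first particle): `∫_{cellN (m+1)} F = ∫_{Y ∈ cellN m} ∫_{x ∈ cell} F(x::Y)` for `F` integrable on the cell
(`measurePreserving_piFinSuccAbove_cellN` as in `TorusFockLayer.integral_conj_modeCr_mul`). -/
theorem integral_cellN_succ (L : ℝ) {F : Config (m + 1) → ℂ} (hF : IntegrableOn F (cellN (m + 1) L) volume) :
    ∫ X in cellN (m + 1) L, F X = ∫ Y in cellN m L, ∫ x in cell L, F (Matrix.vecCons x Y) := by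
  have he := (measurePreserving_piFinSuccAbove_cellN (n := m) 0 L).symm
    (MeasurableEquiv.piFinSuccAbove (fun _ : Fin (m + 1) => Space) 0)
  have hint : Integrable (fun p : Space × Config m => F (Matrix.vecCons p.1 p.2))
      (((volume : Measure Space).restrict (cell L)).prod
        ((volume : Measure (Config m)).restrict (cellN m L))) := by
    have h := (he.integrable_comp_emb (MeasurableEquiv.measurableEmbedding _) (g := F)).2 hF
    refine h.congr (Filter.Eventually.of_forall fun p => ?_)
    simp only [Function.comp_apply, piFinSuccAbove_symm_apply_tk]
  rw [← he.integral_comp' F]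
  simp only [piFinSuccAbove_symm_apply_tk]
  exact integral_prod_symm _ hint

/-- `v^per` is measurable for a measurable profile. -/
theorem measurable_periodizedPotential_tk {w : ℝ → ℝ≥0∞} (hw : Measurable w) (L : ℝ) :
    Measurable (periodizedPotential w L) := by
  show Measurable fun x => ∑' n : Fin 3 → ℤ, w ‖x - latticeVec L n‖
  exact Measurable.tsum fun n =>
    hw.comp (measurable_norm.comp (measurable_id.sub measurable_const))

/-- `W = ∑_{i<j} w^per(xᵢ - xⱼ)` is measurable for a measurable profile. -/
theorem measurable_periodicInteraction_tk {w : ℝ → ℝ≥0∞} (hw : Measurable w) (L : ℝ) :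
    Measurable fun X : Config M => periodicInteraction w L X := by
  unfold periodicInteraction
  refine Finset.measurable_sum _ fun i _ => Finset.measurable_sum _ fun j _ => ?_
  exact measurable_periodizedPotential_pair hw L i j

/-- TK3: `∫_{cell} w^per(x - c) dx = ‖w‖₁` for every `c` (unfolding the periodisation: the translates of the cell tile `ℝ³`;
lintegral form). -/
theorem lintegral_cell_periodizedPotential_sub (hL : 0 < L) {w : ℝ → ℝ≥0∞} (hw : Measurable w) (c : Space) :
    ∫⁻ x in cell L, periodizedPotential w L (x - c) = ∫⁻ z : Space, w ‖z‖ := by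
  unfold periodizedPotential
  rw [lintegral_tsum fun n => ?_]
  · calc ∑' n : Fin 3 → ℤ, ∫⁻ x in cell L, w ‖x - c - latticeVec L n‖
        = ∑' n : Fin 3 → ℤ, ∫⁻ x in cell L, (fun y => w ‖y - c‖) (x - latticeVec L n) := by
          simp only [sub_right_comm _ c]
      _ = ∫⁻ y, w ‖y - c‖ := tsum_lintegral_cell_sub_latticeVec hL (fun y => w ‖y - c‖)
      _ = ∫⁻ z, w ‖z‖ := lintegral_sub_right_eq_self (fun z : Space => w ‖z‖) c
  · exact (hw.comp (measurable_norm.comp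
      ((measurable_id.sub measurable_const).sub measurable_const))).aemeasurable

/-- TK3, mirrored: `∫_{cell} w^per(c - y) dy = ‖w‖₁` for every `c` (`w^per` is even). -/
theorem lintegral_cell_periodizedPotential_sub' (hL : 0 < L) {w : ℝ → ℝ≥0∞} (hw : Measurable w) (c : Space) :
    ∫⁻ y in cell L, periodizedPotential w L (c - y) = ∫⁻ z : Space, w ‖z‖ := by
  simp_rw [periodizedPotential_sub_comm w L c]
  exact lintegral_cell_periodizedPotential_sub hL hw c

/-- TK4: the pair weight is integrable on `cell × cell`: `∫_{x∈cell}∫_{y∈cell} w^per(x - y) = L³‖w‖₁ < ∞`. -/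
theorem lintegral_cell_cell_periodizedPotential (hL : 0 < L) {w : ℝ → ℝ≥0∞} (hw : Measurable w) :
    ∫⁻ x in cell L, ∫⁻ y in cell L, periodizedPotential w L (x - y) = ENNReal.ofReal L ^ 3 * ∫⁻ z : Space, w ‖z‖ := by
  simp_rw [lintegral_cell_periodizedPotential_sub' hL hw]
  rw [setLIntegral_const, volume_cell, mul_comm]

/-! ## The direct term -/

/-- `Fin.tail (x :: Y) = Y`. -/
theorem tail_vecCons_tk (x : Space) (Y : Config m) : Fin.tail (Matrix.vecCons x Y) = Y :=
  funext fun i => Matrix.cons_val_succ x Y i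

/-- `|φ_k(x)|² = L⁻³` in `ℝ≥0∞` (for `0 < L`). -/
theorem nnnorm_planeWaveMode_sq_tk (hL : 0 < L) (k : Fin 3 → ℤ) (x : Space) :
    ((‖planeWaveMode L k x‖₊ : ℝ≥0∞)) ^ 2 = (ENNReal.ofReal L ^ 3)⁻¹ := by
  rw [coe_nnnorm_sq_eq_ofReal, norm_planeWaveMode, inv_pow, Real.sq_sqrt (by positivity),
    ENNReal.ofReal_inv_of_pos (by positivity), ENNReal.ofReal_pow hL.le]

/-- `∫_{cell} (W(Y) + ∑_b w^per(x - y_b)) dx = W(Y) L³ + (m+1)‖w‖₁` (slice integral of TK5's right-hand side). -/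
theorem lintegral_cell_periodicInteraction_add_sum (hL : 0 < L) {w : ℝ → ℝ≥0∞} (hw : Measurable w)
    (Y : Config (m + 1)) :
    ∫⁻ x in cell L, (periodicInteraction w L Y + ∑ b : Fin (m + 1), periodizedPotential w L (x - Y b)) =
      periodicInteraction w L Y * ENNReal.ofReal L ^ 3 + (m + 1 : ℝ≥0∞) * ∫⁻ z : Space, w ‖z‖ := by
  have hmeas : ∀ b : Fin (m + 1), Measurable fun x : Space => periodizedPotential w L (x - Y b) :=
    fun b => (measurable_periodizedPotential_tk hw L).comp (measurable_id.sub measurable_const)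
  rw [lintegral_add_left measurable_const, setLIntegral_const, volume_cell,
    lintegral_finsetSum _ fun b _ => hmeas b]
  simp only [lintegral_cell_periodizedPotential_sub hL hw]
  rw [Finset.sum_const, Finset.card_univ, Fintype.card_fin, nsmul_eq_mul]
  push_cast
  ring

/-- P-dir (direct part of `P[a†Φ]`, an `ℝ≥0∞` identity): for continuous `Φ` (`m+1` particles) and measurable `w`,
`∫_{Z} W_{m+2}(Z) |φ(Z 0)|² |Φ(tail Z)|² dZ = L⁻³ (L³ P[Φ] + (m+1)‖w‖₁‖Φ‖²) = P[Φ] + (m+1)‖w‖₁/L³ · ‖Φ‖²`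
(`|φ|² = L⁻³`, TK1/`lintegral_cellN_succ`, TK5, TK3). -/
theorem lintegral_pot_sq_planeWaveMode_sq_tail (hL : 0 < L) {w : ℝ → ℝ≥0∞} (hw : Measurable w) (k : Fin 3 → ℤ)
    {Φ : Config (m + 1) → ℂ} (hΦ : Continuous Φ) :
    ∫⁻ Z in cellN (m + 2) L, periodicInteraction w L Z *
        (((‖planeWaveMode L k (Z 0)‖₊ : ℝ≥0∞)) ^ 2 * ((‖Φ (Fin.tail Z)‖₊ : ℝ≥0∞)) ^ 2) =
      potForm w L Φ + ENNReal.ofReal ((m + 1) / L ^ 3) * (∫⁻ z : Space, w ‖z‖) * normSq L Φ := by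
  set c : ℝ≥0∞ := (ENNReal.ofReal L ^ 3)⁻¹
  set I : ℝ≥0∞ := ∫⁻ z : Space, w ‖z‖
  have hL3 : ENNReal.ofReal L ^ 3 ≠ 0 := pow_ne_zero _ (ENNReal.ofReal_pos.2 hL).ne'
  have hΦsq : Measurable fun Y : Config (m + 1) => ((‖Φ Y‖₊ : ℝ≥0∞)) ^ 2 :=
    hΦ.measurable.nnnorm.coe_nnreal_ennreal.pow_const _
  have hmeas : Measurable fun Z : Config (m + 2) => periodicInteraction w L Z *
      (((‖planeWaveMode L k (Z 0)‖₊ : ℝ≥0∞)) ^ 2 * ((‖Φ (Fin.tail Z)‖₊ : ℝ≥0∞)) ^ 2) := by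
    refine (measurable_periodicInteraction_tk hw L).fun_mul (Measurable.fun_mul ?_ ?_)
    · exact ((continuous_planeWaveMode L k).measurable.comp
        (measurable_pi_apply 0)).nnnorm.coe_nnreal_ennreal.pow_const _
    · exact hΦsq.comp (measurable_pi_lambda _ fun i => measurable_pi_apply i.succ)
  rw [lintegral_cellN_succ L hmeas]
  -- the slice integral at fixed `Y`
  have hslice : ∀ Y : Config (m + 1),
      ∫⁻ x in cell L, periodicInteraction w L (Matrix.vecCons x Y) *
          (((‖planeWaveMode L k (Matrix.vecCons x Y 0)‖₊ : ℝ≥0∞)) ^ 2 *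
            ((‖Φ (Fin.tail (Matrix.vecCons x Y))‖₊ : ℝ≥0∞)) ^ 2) =
        periodicInteraction w L Y * ((‖Φ Y‖₊ : ℝ≥0∞)) ^ 2 +
          ((m + 1 : ℝ≥0∞) * I * c) * ((‖Φ Y‖₊ : ℝ≥0∞)) ^ 2 := by
    intro Y
    simp only [Matrix.cons_val_zero, tail_vecCons_tk, nnnorm_planeWaveMode_sq_tk hL, periodicInteraction_vecCons]
    have hm : Measurable fun x : Space =>
        periodicInteraction w L Y + ∑ b : Fin (m + 1), periodizedPotential w L (x - Y b) :=
      measurable_const.fun_add (Finset.measurable_sum _ fun b _ =>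
        (measurable_periodizedPotential_tk hw L).comp (measurable_id.sub measurable_const))
    rw [lintegral_mul_const _ hm, lintegral_cell_periodicInteraction_add_sum hL hw Y]
    calc (periodicInteraction w L Y * ENNReal.ofReal L ^ 3 + (m + 1 : ℝ≥0∞) * I) *
          ((ENNReal.ofReal L ^ 3)⁻¹ * ((‖Φ Y‖₊ : ℝ≥0∞)) ^ 2)
        = periodicInteraction w L Y * (ENNReal.ofReal L ^ 3 * (ENNReal.ofReal L ^ 3)⁻¹) *
            ((‖Φ Y‖₊ : ℝ≥0∞)) ^ 2 +
            ((m + 1 : ℝ≥0∞) * I * (ENNReal.ofReal L ^ 3)⁻¹) * ((‖Φ Y‖₊ : ℝ≥0∞)) ^ 2 := by ring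
      _ = _ := by rw [ENNReal.mul_inv_cancel hL3 (ENNReal.pow_ne_top ENNReal.ofReal_ne_top), mul_one]
  simp only [hslice]
  have hWΦ : Measurable fun Y : Config (m + 1) => periodicInteraction w L Y * ((‖Φ Y‖₊ : ℝ≥0∞)) ^ 2 :=
    (measurable_periodicInteraction_tk hw L).fun_mul hΦsq
  rw [lintegral_add_left hWΦ, lintegral_const_mul _ hΦsq]
  have hconst : ENNReal.ofReal ((m + 1) / L ^ 3) = (m + 1 : ℝ≥0∞) * c := by
    rw [ENNReal.ofReal_div_of_pos (by positivity), ENNReal.ofReal_pow hL.le, div_eq_mul_inv,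
      show ((m : ℝ) + 1) = ((m + 1 : ℕ) : ℝ) by push_cast; ring, ENNReal.ofReal_natCast]
    push_cast
    ring
  rw [hconst]
  unfold normSq potForm
  ring

/-! ## The exchange bound -/

/-- `2|u||v| ≤ |u|² + |v|²` for the `ℝ≥0∞`-valued norms. -/
theorem two_mul_enorm_mul_enorm_le_tk (u v : ℂ) :
    2 * (‖u‖ₑ * ‖v‖ₑ) ≤ ((‖u‖₊ : ℝ≥0∞)) ^ 2 + ((‖v‖₊ : ℝ≥0∞)) ^ 2 := by
  rw [enorm_eq_nnnorm, enorm_eq_nnnorm]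
  have h : (2 : NNReal) * (‖u‖₊ * ‖v‖₊) ≤ ‖u‖₊ ^ 2 + ‖v‖₊ ^ 2 := by
    rw [← NNReal.coe_le_coe]
    push_cast
    nlinarith [sq_nonneg (‖u‖ - ‖v‖)]
  exact_mod_cast h

/-- `‖conj z‖ₑ = ‖z‖ₑ`. -/
private theorem enorm_conj_tk (z : ℂ) : ‖conj z‖ₑ = ‖z‖ₑ := by
  rw [← ofReal_norm, Complex.norm_conj, ofReal_norm]

/-- `‖(a.toReal : ℂ)‖ₑ ≤ a` (equality unless `a = ⊤`). -/
theorem enorm_ofReal_toReal_le_tk (a : ℝ≥0∞) : ‖((a.toReal : ℝ) : ℂ)‖ₑ ≤ a := by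
  rw [← ofReal_norm, Complex.norm_real, Real.norm_of_nonneg ENNReal.toReal_nonneg]
  exact ENNReal.ofReal_toReal_le

/-- `|φ_k(x)| |φ_k(y)| = L⁻³` in `ℝ≥0∞`. -/
theorem enorm_planeWaveMode_mul_tk (hL : 0 < L) (k : Fin 3 → ℤ) (x y : Space) :
    ‖planeWaveMode L k x‖ₑ * ‖planeWaveMode L k y‖ₑ = (ENNReal.ofReal L ^ 3)⁻¹ := by
  rw [← ofReal_norm, ← ofReal_norm, norm_planeWaveMode, norm_planeWaveMode,
    ← ENNReal.ofReal_mul (by positivity), ← mul_inv, Real.mul_self_sqrt (by positivity),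
    ENNReal.ofReal_inv_of_pos (by positivity), ENNReal.ofReal_pow hL.le]

/-- The exchange integrand `G(W', x, y) = w^per(x-y) conj φ(x) φ(y) conj Φ(y::W') Φ(x::W')` (so that
`exchCoef w L k Φ = ∫_{W'} ∫_x ∫_y G` by `rfl`). -/
def exchIntegrand (w : ℝ → ℝ≥0∞) (L : ℝ) (k : Fin 3 → ℤ) (Φ : Config (m + 1) → ℂ) (W' : Config m)
    (x y : Space) : ℂ :=
  ((periodizedPotential w L (x - y)).toReal : ℂ) *
    (conj (planeWaveMode L k x) * planeWaveMode L k y * conj (Φ (Matrix.vecCons y W')) * Φ (Matrix.vecCons x W'))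

/-- `E = ∫_{W'} ∫_x ∫_y G(W', x, y)`. -/
theorem exchCoef_eq (w : ℝ → ℝ≥0∞) (L : ℝ) (k : Fin 3 → ℤ) (Φ : Config (m + 1) → ℂ) :
    exchCoef w L k Φ = ∫ W' in cellN m L, ∫ x in cell L, ∫ y in cell L, exchIntegrand w L k Φ W' x y :=
  rfl

/-- Pointwise AM–GM bound on the exchange integrand:
`2|G(W',x,y)| ≤ L⁻³ w^per(x-y) (|Φ(y::W')|² + |Φ(x::W')|²)`. -/
theorem two_mul_enorm_exchIntegrand_le (hL : 0 < L) (w : ℝ → ℝ≥0∞) (k : Fin 3 → ℤ)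
    (Φ : Config (m + 1) → ℂ) (W' : Config m) (x y : Space) :
    2 * ‖exchIntegrand w L k Φ W' x y‖ₑ ≤
      (ENNReal.ofReal L ^ 3)⁻¹ *
          (periodizedPotential w L (x - y) * ((‖Φ (Matrix.vecCons y W')‖₊ : ℝ≥0∞)) ^ 2) +
        (ENNReal.ofReal L ^ 3)⁻¹ *
          (periodizedPotential w L (x - y) * ((‖Φ (Matrix.vecCons x W')‖₊ : ℝ≥0∞)) ^ 2) := by
  unfold exchIntegrand
  simp only [enorm_mul, enorm_conj_tk]
  calc 2 * (‖((periodizedPotential w L (x - y)).toReal : ℂ)‖ₑ *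
        (‖planeWaveMode L k x‖ₑ * ‖planeWaveMode L k y‖ₑ * ‖Φ (Matrix.vecCons y W')‖ₑ *
          ‖Φ (Matrix.vecCons x W')‖ₑ))
      = ‖((periodizedPotential w L (x - y)).toReal : ℂ)‖ₑ *
          (‖planeWaveMode L k x‖ₑ * ‖planeWaveMode L k y‖ₑ) *
          (2 * (‖Φ (Matrix.vecCons y W')‖ₑ * ‖Φ (Matrix.vecCons x W')‖ₑ)) := by ring
    _ ≤ periodizedPotential w L (x - y) * (ENNReal.ofReal L ^ 3)⁻¹ *
          (((‖Φ (Matrix.vecCons y W')‖₊ : ℝ≥0∞)) ^ 2 + ((‖Φ (Matrix.vecCons x W')‖₊ : ℝ≥0∞)) ^ 2) := by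
        rw [enorm_planeWaveMode_mul_tk hL]
        exact mul_le_mul' (mul_le_mul' (enorm_ofReal_toReal_le_tk _) le_rfl)
          (two_mul_enorm_mul_enorm_le_tk _ _)
    _ = _ := by ring

/-- Inner estimate for the exchange term at a fixed spectator configuration `W'`:
`∫_x ∫_y 2|G(W',x,y)| ≤ 2 L⁻³ ‖w‖₁ ∫_x |Φ(x::W')|²` (AM–GM, TK3 in `x` resp. `y`, Tonelli). -/
theorem lintegral_lintegral_two_mul_enorm_exchIntegrand_le (hL : 0 < L) {w : ℝ → ℝ≥0∞} (hw : Measurable w)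
    (k : Fin 3 → ℤ) {Φ : Config (m + 1) → ℂ} (hΦ : Continuous Φ) (W' : Config m) :
    ∫⁻ x in cell L, ∫⁻ y in cell L, 2 * ‖exchIntegrand w L k Φ W' x y‖ₑ ≤
      2 * ((ENNReal.ofReal L ^ 3)⁻¹ * (∫⁻ z : Space, w ‖z‖) *
        ∫⁻ x in cell L, ((‖Φ (Matrix.vecCons x W')‖₊ : ℝ≥0∞)) ^ 2) := by
  set c : ℝ≥0∞ := (ENNReal.ofReal L ^ 3)⁻¹
  set I : ℝ≥0∞ := ∫⁻ z : Space, w ‖z‖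
  set S : Space → ℝ≥0∞ := fun x => ((‖Φ (Matrix.vecCons x W')‖₊ : ℝ≥0∞)) ^ 2
  have hSm : Measurable S :=
    (hΦ.comp (continuous_id.matrixVecCons continuous_const)).measurable.nnnorm.coe_nnreal_ennreal.pow_const
      _
  have hPx : ∀ x : Space, Measurable fun y : Space => periodizedPotential w L (x - y) :=
    fun x => (measurable_periodizedPotential_tk hw L).comp (measurable_const.sub measurable_id)
  have hPy : ∀ y : Space, Measurable fun x : Space => periodizedPotential w L (x - y) :=
    fun y => (measurable_periodizedPotential_tk hw L).comp (measurable_id.sub measurable_const)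
  have hA : Measurable fun p : Space × Space => periodizedPotential w L (p.1 - p.2) * S p.2 :=
    ((measurable_periodizedPotential_tk hw L).comp (measurable_fst.sub measurable_snd)).mul
      (hSm.comp measurable_snd)
  -- the `y`-integration at fixed `x`
  have h1 : ∀ x : Space, ∫⁻ y in cell L, 2 * ‖exchIntegrand w L k Φ W' x y‖ₑ ≤
      c * (∫⁻ y in cell L, periodizedPotential w L (x - y) * S y) + c * (I * S x) := by
    intro x
    have hm1 : Measurable fun y : Space => periodizedPotential w L (x - y) * S y :=
      (hPx x).mul hSm
    have hm2 : Measurable fun y : Space => periodizedPotential w L (x - y) * S x :=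
      (hPx x).mul_const _
    calc ∫⁻ y in cell L, 2 * ‖exchIntegrand w L k Φ W' x y‖ₑ
        ≤ ∫⁻ y in cell L, (c * (periodizedPotential w L (x - y) * S y) +
            c * (periodizedPotential w L (x - y) * S x)) :=
          lintegral_mono fun y => two_mul_enorm_exchIntegrand_le hL w k Φ W' x y
      _ = c * (∫⁻ y in cell L, periodizedPotential w L (x - y) * S y) +
            c * ((∫⁻ y in cell L, periodizedPotential w L (x - y)) * S x) := by
          rw [lintegral_add_left (hm1.const_mul c), lintegral_const_mul c hm1,
            lintegral_const_mul c hm2, lintegral_mul_const _ (hPx x)]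
      _ = c * (∫⁻ y in cell L, periodizedPotential w L (x - y) * S y) + c * (I * S x) := by
          rw [lintegral_cell_periodizedPotential_sub' hL hw x]
  -- the `x`-integration, with Tonelli in the first term
  have hswap : ∫⁻ x in cell L, ∫⁻ y in cell L, periodizedPotential w L (x - y) * S y =
      I * ∫⁻ y in cell L, S y := by
    rw [lintegral_lintegral_swap hA.aemeasurable]
    have h2 : ∀ y : Space, ∫⁻ x in cell L, periodizedPotential w L (x - y) * S y = I * S y := by
      intro y
      rw [lintegral_mul_const _ (hPy y), lintegral_cell_periodizedPotential_sub hL hw y]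
    simp only [h2]
    exact lintegral_const_mul I hSm
  have hm3 : Measurable fun x : Space => c * (I * S x) := (hSm.const_mul I).const_mul c
  calc ∫⁻ x in cell L, ∫⁻ y in cell L, 2 * ‖exchIntegrand w L k Φ W' x y‖ₑ
      ≤ ∫⁻ x in cell L, (c * (∫⁻ y in cell L, periodizedPotential w L (x - y) * S y) + c * (I * S x)) :=
        lintegral_mono h1
    _ = c * (I * ∫⁻ y in cell L, S y) + c * (I * ∫⁻ x in cell L, S x) := by
        rw [lintegral_add_right _ hm3, lintegral_const_mul c hA.lintegral_prod_right', hswap,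
          lintegral_const_mul c (hSm.const_mul I), lintegral_const_mul I hSm]
    _ = 2 * (c * I * ∫⁻ x in cell L, S x) := by ring

/-- P-c (exchange bound): `|Re E| ≤ ‖w‖₁/L³ ‖Φ‖²`. -/
theorem abs_exchCoef_re_le (hL : 0 < L) {w : ℝ → ℝ≥0∞} (hw : Measurable w) (hint : (∫⁻ z : Space, w ‖z‖) ≠ ⊤) (k : Fin 3 → ℤ)
    {Φ : Config (m + 1) → ℂ} (hΦ : Continuous Φ) :
    |(exchCoef w L k Φ).re| ≤ wL1 w / L ^ 3 * (normSq L Φ).toReal := by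
  set c : ℝ≥0∞ := (ENNReal.ofReal L ^ 3)⁻¹ with hc
  have hwL1 : wL1 w = (∫⁻ z : Space, w ‖z‖).toReal := rfl
  set I : ℝ≥0∞ := ∫⁻ z : Space, w ‖z‖
  have hc_top : c ≠ ⊤ := ENNReal.inv_ne_top.2 (pow_ne_zero _ (ENNReal.ofReal_pos.2 hL).ne')
  have h2top : (2 : ℝ≥0∞) ≠ ⊤ := ENNReal.ofNat_ne_top
  have hΦsq : Measurable fun Y : Config (m + 1) => ((‖Φ Y‖₊ : ℝ≥0∞)) ^ 2 :=
    hΦ.measurable.nnnorm.coe_nnreal_ennreal.pow_const _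
  -- `‖Φ‖²` as an iterated integral
  have hnormSq : normSq L Φ =
      ∫⁻ W' in cellN m L, ∫⁻ x in cell L, ((‖Φ (Matrix.vecCons x W')‖₊ : ℝ≥0∞)) ^ 2 :=
    lintegral_cellN_succ L hΦsq
  -- `‖E‖ₑ ≤ ∫∫∫ |G|`
  have hE : ‖exchCoef w L k Φ‖ₑ ≤
      ∫⁻ W' in cellN m L, ∫⁻ x in cell L, ∫⁻ y in cell L, ‖exchIntegrand w L k Φ W' x y‖ₑ := by
    rw [exchCoef_eq]
    refine (enorm_integral_le_lintegral_enorm _).trans (lintegral_mono fun W' => ?_)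
    refine (enorm_integral_le_lintegral_enorm _).trans (lintegral_mono fun x => ?_)
    exact enorm_integral_le_lintegral_enorm _
  -- `2‖E‖ₑ ≤ 2 L⁻³ ‖w‖₁ ‖Φ‖²`
  have h2 : 2 * ‖exchCoef w L k Φ‖ₑ ≤ 2 * (c * I * normSq L Φ) := by
    calc 2 * ‖exchCoef w L k Φ‖ₑ
        ≤ 2 * ∫⁻ W' in cellN m L, ∫⁻ x in cell L, ∫⁻ y in cell L, ‖exchIntegrand w L k Φ W' x y‖ₑ :=
          mul_le_mul_right hE 2
      _ = ∫⁻ W' in cellN m L, ∫⁻ x in cell L, ∫⁻ y in cell L, 2 * ‖exchIntegrand w L k Φ W' x y‖ₑ := by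
          rw [← lintegral_const_mul' (2 : ℝ≥0∞) _ h2top]
          refine lintegral_congr fun W' => ?_
          rw [← lintegral_const_mul' (2 : ℝ≥0∞) _ h2top]
          refine lintegral_congr fun x => ?_
          rw [← lintegral_const_mul' (2 : ℝ≥0∞) _ h2top]
      _ ≤ ∫⁻ W' in cellN m L, 2 * (c * I * ∫⁻ x in cell L, ((‖Φ (Matrix.vecCons x W')‖₊ : ℝ≥0∞)) ^ 2) :=
          lintegral_mono fun W' => lintegral_lintegral_two_mul_enorm_exchIntegrand_le hL hw k hΦ W'
      _ = 2 * (c * I * normSq L Φ) := by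
          rw [lintegral_const_mul' (2 : ℝ≥0∞) _ h2top,
            lintegral_const_mul' (c * I) _ (ENNReal.mul_ne_top hc_top hint), hnormSq]
  have h3 : ‖exchCoef w L k Φ‖ₑ ≤ c * I * normSq L Φ :=
    (ENNReal.mul_le_mul_iff_right two_ne_zero h2top).1 h2
  have hfin : c * I * normSq L Φ ≠ ⊤ :=
    ENNReal.mul_ne_top (ENNReal.mul_ne_top hc_top hint) (lintegral_cellN_sq_lt_top L hΦ).ne
  calc |(exchCoef w L k Φ).re| ≤ ‖exchCoef w L k Φ‖ := Complex.abs_re_le_norm _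
    _ = ‖exchCoef w L k Φ‖ₑ.toReal := (toReal_enorm _).symm
    _ ≤ (c * I * normSq L Φ).toReal := ENNReal.toReal_mono hfin h3
    _ = wL1 w / L ^ 3 * (normSq L Φ).toReal := by
        rw [ENNReal.toReal_mul, ENNReal.toReal_mul, hwL1, hc, ENNReal.toReal_inv, ENNReal.toReal_pow,
          ENNReal.toReal_ofReal hL.le]
        ring

end Summit.AtomisticToContinuum.BoseEinsteinCondensation.Cruxes.PeriodicIRBound.LinearPhFloorWagner.WF

end

namespace Summit.AtomisticToContinuum.BoseEinsteinCondensation.Cruxes.PeriodicIRBound.LinearPhFloorWagner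

/-- The registered sub-goal `stub_wfPotToolkit` of the crux ledger: this file's headline lemma `WF.abs_exchCoef_re_le`. -/
theorem stub_wfPotToolkit : WF.Pkg.PotToolkit :=
  @WF.abs_exchCoef_re_le

end Summit.AtomisticToContinuum.BoseEinsteinCondensation.Cruxes.PeriodicIRBound.LinearPhFloorWagner
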